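import Literature.NumberTheory.NumberFields.DihedralUnitIdentities
import HarnessLib

/-!
# Units in an `S₃`-extension, II: the quadratic step `L/K` and the resolvent step `R/k` have the same
# unit cohomology — `#H¹(⟨τ⟩, E_L) = #H¹(Gal(R/k), E_R)`,
# `[E_K ∩ N_{L/K} Lˣ : N_{L/K} E_L] = [E_k ∩ N_{R/k} Rˣ : N_{R/k} E_R]`, `[E_K : E_K ∩ N Lˣ] = [E_k : E_k ∩ N Rˣ]`

Topic `NumberTheory/NumberFields`; namespace `Literature.NumberTheory.NumberFields.DihedralUnits`.
THEOREM-ONLY file (no definition, no named fact, no `sorry`), written by the prover seat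
`bsd-line-att-p4` g30 (cell `bsd-f1-sign2`, route `AlignedTransportAtTwo`, `--supports`
stmt-BirchSwinnertonDyer-22298; closes nothing; BSD is proved for no curve here).  Sequel of
`DihedralUnitIdentities.lean` (setting and notation there): the three unit indices entering the tree's
Chevalley calculus (`AmbiguousClassIndexFormula.lean`: `#C^G · #H¹(G, E) = h · ∏e_𝔭 · [E_base ∩ N : N E]`,
and `[E_base : E_base ∩ N]` of `ambiguousClassNumberFormula`) COINCIDE for the quadratic step `L/K`
(`K = L^τ`) and the resolvent step `R/k` (`R = L^σ`, `k = L^{σ,τ}`) of an `S₃`-extension `L/k`: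

* **`h1_unitsE_eq`** — `h1 τK E_L = h1 δ E_R`, i.e. `#H¹(⟨τ⟩, E_L) = #H¹(⟨δ⟩, E_R)`: under
  `φ : Rˣ → Lˣ`, `φ(Z¹_R) · B¹_L = Z¹_L` (every cocycle is its `σ`-norm times a coboundary, (U4)) and
  `φ(Z¹_R) ∩ B¹_L = φ(B¹_R)` ((U5)).  This is the unit-module content of the cohomological lemma
  `res : Ĥⁱ(S₃, E_L)₂ ≅ Ĥⁱ(⟨τ⟩, E_L)` (trivial-intersection Sylow `2`-subgroup, Cartan–Eilenberg stable
  elements) composed with `Ĥⁱ(S₃, E_L)₂ = Ĥⁱ(S₃/C₃, E_L^{C₃})` — here with no cohomological machinery.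
* **`relIndex_norm_unitsE_eq`** — `[E_K ∩ N_{L/K}Lˣ : N_{L/K}E_L] = [E_k ∩ N_{R/k}Rˣ : N_{R/k}E_R]`
  ((U1): `E_K = E_k·N E_L`; (U2): `E_k ∩ N Lˣ = E_k ∩ N Rˣ`, `E_k ∩ N E_L = N E_R`).
* **`relIndex_unitsK_eq`** — `[E_K : E_K ∩ N_{L/K}Lˣ] = [E_k : E_k ∩ N_{R/k}Rˣ]` (same two facts).

Each is proved by the pattern `φ(X_R) ⊔ Y_L = X_L`, `Y_L ⊓ φ(X_R) = φ(Y_R)` and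
`[X_L : Y_L] = [φ X_R ⊔ Y_L : Y_L] = [φ X_R : Y_L ∩ φ X_R] = [X_R : Y_R]` (`φ` injective).  Sequel:
`DihedralRamifiedPrimesComparison.lean`, `KurodaRelationSymmetricThreeExact.lean`.

References: [CaputoNuccio2020] L. Caputo, F. A. E. Nuccio Mortarino Majno di Capriglio, Glasgow Math. J.
62 (2020) 323–353 (arXiv:1803.04064), Prop. 2.1, Lemma 2.9, Prop. 3.12 (Walter); [Bartel2012] Cor. 5.2;
[Lang1990] Ch. 13 §4 Lemma 4.1; H. Cartan, S. Eilenberg, *Homological Algebra* (1956) XII §9–10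
(stable elements).
-/

noncomputable section

open scoped NumberField

namespace Literature.NumberTheory.NumberFields.DihedralUnits

open Literature.NumberTheory.GaloisRepresentations Literature.NumberTheory.GaloisRepresentations.Herbrand
  Literature.NumberTheory.GaloisRepresentations.MinkowskiUnit
  Literature.NumberTheory.GaloisRepresentations.CyclicNormIndex


/-! ### The index identities -/

section Indices

variable {k R L : Type} [Field k] [NumberField k] [Field R] [NumberField R] [Field L] [NumberField L]
  [Algebra k R] [Algebra k L] [Algebra R L]
  {K : Type} [Field K] [NumberField K] [Algebra K L] [IsGalois K L] [IsGalois k R]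
  {σ τ : L ≃ₐ[k] L} {τK : L ≃ₐ[K] L} {δ : R ≃ₐ[k] R}

omit [IsGalois K L] [IsGalois k R] in
/-- **`H¹(⟨τ⟩, E_L) ≅ H¹(Gal(R/k), E_R)`** (equality of the orders `h1` of the tree's cyclic calculus):
the unit cocycles of the quadratic step `L/K` of an `S₃`-extension are, up to coboundaries, those of the
resolvent step `R/k`, and no more coboundaries appear — the unit-module content of
`res : Ĥⁱ(D, E_L)₂ ≅ Ĥⁱ(⟨τ⟩, E_L)` (trivial-intersection Sylow `2`-subgroup) combined with
`Ĥⁱ(D, E_L)₂ = Ĥⁱ(D/C₃, E_L^{C₃})`. [cite: CaputoNuccio2020, Lemma 2.9 and Prop. 2.1] -/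
theorem h1_unitsE_eq (hσ : σ ^ 3 = 1) (hτ : τ ^ 2 = 1) (hτσ : τ * σ = σ ^ 2 * τ) (hτ1 : τ ≠ 1)
    (hτK : ∀ x : L, τK x = τ x) (hgenK : ∀ g : L ≃ₐ[K] L, g ∈ Subgroup.zpowers τK)
    (hR : ∀ x : L, σ x = x ↔ x ∈ Set.range (algebraMap R L))
    (hδ : ∀ y : R, algebraMap R L (δ y) = τ (algebraMap R L y))
    (hgenk : ∀ g : R ≃ₐ[k] R, g ∈ Subgroup.zpowers δ) (hδ1 : δ ≠ 1) :
    h1 τK (unitsE L) ⊥ = h1 δ (unitsE R) ⊥ := by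
  have hφ : Function.Injective (unitsIncl R L) := unitsIncl_injective
  have hN3 : ∀ {u : Lˣ}, u ∈ unitsE L → u * σ • u * σ • (σ • u) ∈ unitsE L := fun hu =>
    Subgroup.mul_mem _ (Subgroup.mul_mem _ hu (smul_mem_unitsE σ hu))
      (smul_mem_unitsE σ (smul_mem_unitsE σ hu))
  -- membership descriptions
  have hZ : ∀ u : Lˣ, u ∈ z1 (L ≃ₐ[K] L) (unitsE L) ⊥ ↔ u ∈ unitsE L ∧ u * τ • u = 1 := fun u => by
    rw [mem_z1_bot, norm_K_eq hτ hτ1 hτK hgenK]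
  have hB : ∀ u : Lˣ, u ∈ b1 τK (unitsE L) ⊥ ↔ ∃ v ∈ unitsE L, τ • v / v = u := fun u => by
    rw [b1_bot, Subgroup.mem_map]
    simp only [twist_apply, smul_eq_of_apply_eq hτK]
  have hZ' : ∀ u : Lˣ, u ∈ (z1 (R ≃ₐ[k] R) (unitsE R) ⊥).map (unitsIncl R L) ↔
      u ∈ unitsE L ∧ σ • u = u ∧ u * τ • u = 1 := fun u => by
    rw [Subgroup.mem_map]
    constructor
    · rintro ⟨y, hy, rfl⟩
      rw [mem_z1_bot, norm_k_eq hτ hδ hgenk hδ1] at hy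
      refine ⟨(unitsIncl_mem_unitsE_iff y).mpr hy.1, smul_unitsIncl_eq hR y, ?_⟩
      rw [← unitsIncl_mul_smul hδ, hy.2, map_one]
    · rintro ⟨hu, hσu, hu1⟩
      obtain ⟨y, hy, rfl⟩ := exists_unitsE_R_of_fixed hR hu hσu
      refine ⟨y, mem_z1_bot.mpr ⟨hy, hφ ?_⟩, rfl⟩
      rw [norm_k_eq hτ hδ hgenk hδ1, unitsIncl_mul_smul hδ, hu1, map_one]
  have hB' : ∀ u : Lˣ, u ∈ (b1 δ (unitsE R) ⊥).map (unitsIncl R L) ↔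
      ∃ w ∈ unitsE L, σ • w = w ∧ τ • w / w = u := fun u => by
    rw [b1_bot, Subgroup.map_map, Subgroup.mem_map]
    constructor
    · rintro ⟨y, hy, rfl⟩
      exact ⟨unitsIncl R L y, (unitsIncl_mem_unitsE_iff y).mpr hy, smul_unitsIncl_eq hR y,
        (unitsIncl_twist hδ y).symm⟩
    · rintro ⟨w, hw, hσw, rfl⟩
      obtain ⟨y, hy, rfl⟩ := exists_unitsE_R_of_fixed hR hw hσw
      exact ⟨y, hy, unitsIncl_twist hδ y⟩
  -- the two subgroup identities
  have hsup : (z1 (R ≃ₐ[k] R) (unitsE R) ⊥).map (unitsIncl R L) ⊔ b1 τK (unitsE L) ⊥ =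
      z1 (L ≃ₐ[K] L) (unitsE L) ⊥ := by
    refine le_antisymm (sup_le (fun u hu => ?_)
      (b1_le_z1 isStable_unitsE Herbrand.IsStable.bot bot_le)) (fun u hu => ?_)
    · obtain ⟨hu, -, hu1⟩ := (hZ' u).mp hu
      exact (hZ u).mpr ⟨hu, hu1⟩
    · obtain ⟨hu, hu1⟩ := (hZ u).mp hu
      rw [eq_norm3_mul_twist_of_cocycle hτσ hu1]
      exact Subgroup.mul_mem_sup ((hZ' _).mpr ⟨hN3 hu, norm3_cocycle hσ hτσ hu1⟩)
        ((hB _).mpr ⟨σ • u, smul_mem_unitsE σ hu, rfl⟩)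
  have hinf : (z1 (R ≃ₐ[k] R) (unitsE R) ⊥).map (unitsIncl R L) ⊓ b1 τK (unitsE L) ⊥ =
      (b1 δ (unitsE R) ⊥).map (unitsIncl R L) := by
    refine le_antisymm (fun u hu => ?_) (le_inf
      (Subgroup.map_mono (b1_le_z1 isStable_unitsE Herbrand.IsStable.bot bot_le)) (fun u hu => ?_))
    · obtain ⟨huZ, hub⟩ := Subgroup.mem_inf.mp hu
      obtain ⟨hu, hσu, hu1⟩ := (hZ' u).mp huZ
      obtain ⟨v, hv, hvu⟩ := (hB u).mp hub
      obtain ⟨h1, h2⟩ := eq_twist_norm3_of_fixed_cocycle hσ hτσ hσu hu1 hvu.symm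
      exact (hB' _).mpr ⟨_, Subgroup.mul_mem _ (hN3 hv) hu, h2, h1.symm⟩
    · obtain ⟨w, hw, -, rfl⟩ := (hB' u).mp hu
      exact (hB _).mpr ⟨w, hw, rfl⟩
  -- index bookkeeping
  rw [h1_def, h1_def, ← Subgroup.relIndex_map_map_of_injective (b1 δ (unitsE R) ⊥)
    (z1 (R ≃ₐ[k] R) (unitsE R) ⊥) hφ, ← hinf, inf_comm, Subgroup.inf_relIndex_right, ← hsup,
    Subgroup.relIndex_sup_right]

omit [IsGalois K L] [IsGalois k R] in
/-- **`[E_K ∩ N_{L/K} Lˣ : N_{L/K} E_L] = [E_k ∩ N_{R/k} Rˣ : N_{R/k} E_R]`** — the order of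
`H¹(G, P_L)` in Chevalley's calculus (`AmbiguousClass.h1_principals_eq_relIndex`) is the same for the
quadratic step and for the resolvent step of an `S₃`-extension (`E_K = E_k · N_{L/K}E_L`,
`E_k ∩ N_{L/K}Lˣ = E_k ∩ N_{R/k}Rˣ`, `E_k ∩ N_{L/K}E_L = N_{R/k}E_R`).
[cite: CaputoNuccio2020, Prop. 2.1, Lemma 2.9] -/
theorem relIndex_norm_unitsE_eq (hσ : σ ^ 3 = 1) (hτ : τ ^ 2 = 1) (hτσ : τ * σ = σ ^ 2 * τ)
    (hτ1 : τ ≠ 1) (hτK : ∀ x : L, τK x = τ x) (hgenK : ∀ g : L ≃ₐ[K] L, g ∈ Subgroup.zpowers τK)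
    (hR : ∀ x : L, σ x = x ↔ x ∈ Set.range (algebraMap R L))
    (hδ : ∀ y : R, algebraMap R L (δ y) = τ (algebraMap R L y))
    (hgenk : ∀ g : R ≃ₐ[k] R, g ∈ Subgroup.zpowers δ) (hδ1 : δ ≠ 1) :
    ((unitsE L).map (Herbrand.norm (L ≃ₐ[K] L))).relIndex
        (unitsE L ⊓ (⊤ : Subgroup Lˣ).map (Herbrand.norm (L ≃ₐ[K] L))) =
      ((unitsE R).map (Herbrand.norm (R ≃ₐ[k] R))).relIndex
        (unitsE R ⊓ (⊤ : Subgroup Rˣ).map (Herbrand.norm (R ≃ₐ[k] R))) := by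
  have hφ : Function.Injective (unitsIncl R L) := unitsIncl_injective
  have hN3 : ∀ {u : Lˣ}, u ∈ unitsE L → u * σ • u * σ • (σ • u) ∈ unitsE L := fun hu =>
    Subgroup.mul_mem _ (Subgroup.mul_mem _ hu (smul_mem_unitsE σ hu))
      (smul_mem_unitsE σ (smul_mem_unitsE σ hu))
  have hNK : ∀ x : Lˣ, Herbrand.norm (L ≃ₐ[K] L) x = x * τ • x := norm_K_eq hτ hτ1 hτK hgenK
  have hNk : ∀ y : Rˣ, Herbrand.norm (R ≃ₐ[k] R) y = y * δ • y := norm_k_eq hτ hδ hgenk hδ1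
  have hA : ∀ u : Lˣ, u ∈ unitsE L ⊓ (⊤ : Subgroup Lˣ).map (Herbrand.norm (L ≃ₐ[K] L)) ↔
      u ∈ unitsE L ∧ ∃ x : Lˣ, x * τ • x = u := fun u => by
    simp only [Subgroup.mem_inf, Subgroup.mem_map, Subgroup.mem_top, true_and, hNK]
  have hB : ∀ u : Lˣ, u ∈ (unitsE L).map (Herbrand.norm (L ≃ₐ[K] L)) ↔
      ∃ v ∈ unitsE L, v * τ • v = u := fun u => by
    simp only [Subgroup.mem_map, hNK]
  have hA' : ∀ u : Lˣ, u ∈ (unitsE R ⊓ (⊤ : Subgroup Rˣ).map (Herbrand.norm (R ≃ₐ[k] R))).map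
      (unitsIncl R L) ↔ u ∈ unitsE L ∧ σ • u = u ∧ ∃ x : Lˣ, σ • x = x ∧ x * τ • x = u := fun u => by
    constructor
    · rintro ⟨y, ⟨hy, x, -, rfl⟩, rfl⟩
      refine ⟨(unitsIncl_mem_unitsE_iff _).mpr hy, smul_unitsIncl_eq hR _, unitsIncl R L x,
        smul_unitsIncl_eq hR x, ?_⟩
      rw [hNk, unitsIncl_mul_smul hδ]
    · rintro ⟨hu, -, x, hσx, rfl⟩
      obtain ⟨z, rfl⟩ := (smul_eq_self_iff_mem_range hR x).mp hσx
      have hz : z * δ • z ∈ unitsE R := by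
        rw [← unitsIncl_mem_unitsE_iff (L := L), unitsIncl_mul_smul hδ]; exact hu
      exact ⟨z * δ • z, ⟨hz, z, Subgroup.mem_top _, hNk z⟩, unitsIncl_mul_smul hδ z⟩
  have hB' : ∀ u : Lˣ, u ∈ ((unitsE R).map (Herbrand.norm (R ≃ₐ[k] R))).map (unitsIncl R L) ↔
      ∃ v ∈ unitsE L, σ • v = v ∧ v * τ • v = u := fun u => by
    rw [Subgroup.map_map, Subgroup.mem_map]
    constructor
    · rintro ⟨y, hy, rfl⟩
      refine ⟨unitsIncl R L y, (unitsIncl_mem_unitsE_iff y).mpr hy, smul_unitsIncl_eq hR y, ?_⟩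
      rw [MonoidHom.comp_apply, hNk, unitsIncl_mul_smul hδ]
    · rintro ⟨v, hv, hσv, rfl⟩
      obtain ⟨y, hy, rfl⟩ := exists_unitsE_R_of_fixed hR hv hσv
      exact ⟨y, hy, by rw [MonoidHom.comp_apply, hNk, unitsIncl_mul_smul hδ]⟩
  -- a norm `x τx` which is a `⟨σ,τ⟩`-fixed unit is `y τy` with `y` a `σ`-fixed element
  have key : ∀ {u x : Lˣ}, u ∈ unitsE L → σ • u = u → x * τ • x = u →
      ∃ y : Lˣ, σ • y = y ∧ y * τ • y = u := fun {u x} hu hσu hxu => by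
    have hτu : τ • u = u := by rw [← hxu, smul_mul', tau_smul_two hτ, mul_comm]
    obtain ⟨e1, e2⟩ := eq_norm_norm3_of_fixed_norm hσ hτσ hσu hτu hxu.symm
    exact ⟨_, e2, e1.symm⟩
  have hsup : (unitsE R ⊓ (⊤ : Subgroup Rˣ).map (Herbrand.norm (R ≃ₐ[k] R))).map (unitsIncl R L) ⊔
      (unitsE L).map (Herbrand.norm (L ≃ₐ[K] L)) =
      unitsE L ⊓ (⊤ : Subgroup Lˣ).map (Herbrand.norm (L ≃ₐ[K] L)) := by
    refine le_antisymm (sup_le (fun u hu => ?_) (fun u hu => ?_)) (fun u hu => ?_)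
    · obtain ⟨hu, -, x, -, hx⟩ := (hA' u).mp hu
      exact (hA u).mpr ⟨hu, x, hx⟩
    · obtain ⟨v, hv, rfl⟩ := (hB u).mp hu
      exact (hA _).mpr ⟨Subgroup.mul_mem _ hv (smul_mem_unitsE τ hv), v, rfl⟩
    · obtain ⟨hu, x, hxu⟩ := (hA u).mp hu
      have hτu : τ • u = u := by rw [← hxu, smul_mul', tau_smul_two hτ, mul_comm]
      obtain ⟨h1, h2, -⟩ := eq_norm3_mul_norm_of_fixed hσ hτσ hτu
      rw [h1]
      refine Subgroup.mul_mem_sup ((hA' _).mpr ⟨hN3 hu, h2, key (hN3 hu) h2 (x := x * σ • u) ?_⟩)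
        ((hB _).mpr ⟨(σ • u)⁻¹, Subgroup.inv_mem _ (smul_mem_unitsE σ hu), rfl⟩)
      rw [smul_sq_eq_tau_smul hτσ hτu, smul_mul',
        show u * σ • u * τ • (σ • u) = x * τ • x * σ • u * τ • (σ • u) by rw [hxu], Units.ext_iff]
      push_cast
      ring
  have hinf : (unitsE L).map (Herbrand.norm (L ≃ₐ[K] L)) ⊓
      (unitsE R ⊓ (⊤ : Subgroup Rˣ).map (Herbrand.norm (R ≃ₐ[k] R))).map (unitsIncl R L) =
      ((unitsE R).map (Herbrand.norm (R ≃ₐ[k] R))).map (unitsIncl R L) := by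
    refine le_antisymm (fun u hu => ?_) (fun u hu => ?_)
    · obtain ⟨hub, huA⟩ := Subgroup.mem_inf.mp hu
      obtain ⟨hu, hσu, -⟩ := (hA' u).mp huA
      obtain ⟨v, hv, hvu⟩ := (hB u).mp hub
      have hτu : τ • u = u := by rw [← hvu, smul_mul', tau_smul_two hτ, mul_comm]
      obtain ⟨e1, e2⟩ := eq_norm_norm3_of_fixed_norm hσ hτσ hσu hτu hvu.symm
      exact (hB' u).mpr ⟨_, Subgroup.div_mem _ (hN3 hv) hu, e2, e1.symm⟩
    · obtain ⟨v, hv, hσv, rfl⟩ := (hB' u).mp hu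
      refine Subgroup.mem_inf.mpr ⟨(hB _).mpr ⟨v, hv, rfl⟩, (hA' _).mpr
        ⟨Subgroup.mul_mem _ hv (smul_mem_unitsE τ hv), ?_, v, hσv, rfl⟩⟩
      rw [smul_mul', hσv, ← tau_smul_sigma_smul_sigma_smul hσ hτσ, hσv, hσv]
  rw [← Subgroup.relIndex_map_map_of_injective ((unitsE R).map (Herbrand.norm (R ≃ₐ[k] R)))
    (unitsE R ⊓ (⊤ : Subgroup Rˣ).map (Herbrand.norm (R ≃ₐ[k] R))) hφ, ← hinf,
    Subgroup.inf_relIndex_right, ← hsup, Subgroup.relIndex_sup_right]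

/-- **`[E_K : E_K ∩ N_{L/K} Lˣ] = [E_k : E_k ∩ N_{R/k} Rˣ]`** — the unit norm index of
Chevalley's ambiguous class number formula is the same for the quadratic step `L/K` and the resolvent
step `R/k` of an `S₃`-extension (`E_K = E_k · N_{L/K} E_L` and `E_k ∩ N_{L/K}Lˣ = E_k ∩ N_{R/k}Rˣ`).
[cite: CaputoNuccio2020, Prop. 2.1, Lemma 2.9] [cite: Lang1990, Ch. 13 §4 Lemma 4.1] -/
theorem relIndex_unitsK_eq (hσ : σ ^ 3 = 1) (hτ : τ ^ 2 = 1) (hτσ : τ * σ = σ ^ 2 * τ)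
    (hτ1 : τ ≠ 1) (hτK : ∀ x : L, τK x = τ x) (hgenK : ∀ g : L ≃ₐ[K] L, g ∈ Subgroup.zpowers τK)
    (hR : ∀ x : L, σ x = x ↔ x ∈ Set.range (algebraMap R L))
    (hδ : ∀ y : R, algebraMap R L (δ y) = τ (algebraMap R L y))
    (hgenk : ∀ g : R ≃ₐ[k] R, g ∈ Subgroup.zpowers δ) (hδ1 : δ ≠ 1) :
    (unitsE L ⊓ (⊤ : Subgroup Lˣ).map (Herbrand.norm (L ≃ₐ[K] L))).relIndex
        (unitsE L ⊓ (unitsIncl K L).range) =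
      (unitsE R ⊓ (⊤ : Subgroup Rˣ).map (Herbrand.norm (R ≃ₐ[k] R))).relIndex
        (unitsE R ⊓ (unitsIncl k R).range) := by
  have hφ : Function.Injective (unitsIncl R L) := unitsIncl_injective
  have hN3 : ∀ {u : Lˣ}, u ∈ unitsE L → u * σ • u * σ • (σ • u) ∈ unitsE L := fun hu =>
    Subgroup.mul_mem _ (Subgroup.mul_mem _ hu (smul_mem_unitsE σ hu))
      (smul_mem_unitsE σ (smul_mem_unitsE σ hu))
  have hNK : ∀ x : Lˣ, Herbrand.norm (L ≃ₐ[K] L) x = x * τ • x := norm_K_eq hτ hτ1 hτK hgenK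
  have hNk : ∀ y : Rˣ, Herbrand.norm (R ≃ₐ[k] R) y = y * δ • y := norm_k_eq hτ hδ hgenk hδ1
  have hA : ∀ u : Lˣ, u ∈ unitsE L ⊓ (⊤ : Subgroup Lˣ).map (Herbrand.norm (L ≃ₐ[K] L)) ↔
      u ∈ unitsE L ∧ ∃ x : Lˣ, x * τ • x = u := fun u => by
    simp only [Subgroup.mem_inf, Subgroup.mem_map, Subgroup.mem_top, true_and, hNK]
  have hE : ∀ u : Lˣ, u ∈ unitsE L ⊓ (unitsIncl K L).range ↔ u ∈ unitsE L ∧ τ • u = u := fun u => by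
    rw [Subgroup.mem_inf, mem_range_unitsIncl_K_iff hτK hgenK]
  have hA' : ∀ u : Lˣ, u ∈ (unitsE R ⊓ (⊤ : Subgroup Rˣ).map (Herbrand.norm (R ≃ₐ[k] R))).map
      (unitsIncl R L) ↔ u ∈ unitsE L ∧ σ • u = u ∧ ∃ x : Lˣ, σ • x = x ∧ x * τ • x = u := fun u => by
    constructor
    · rintro ⟨y, ⟨hy, x, -, rfl⟩, rfl⟩
      refine ⟨(unitsIncl_mem_unitsE_iff _).mpr hy, smul_unitsIncl_eq hR _, unitsIncl R L x,
        smul_unitsIncl_eq hR x, ?_⟩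
      rw [hNk, unitsIncl_mul_smul hδ]
    · rintro ⟨hu, -, x, hσx, rfl⟩
      obtain ⟨z, rfl⟩ := (smul_eq_self_iff_mem_range hR x).mp hσx
      have hz : z * δ • z ∈ unitsE R := by
        rw [← unitsIncl_mem_unitsE_iff (L := L), unitsIncl_mul_smul hδ]; exact hu
      exact ⟨z * δ • z, ⟨hz, z, Subgroup.mem_top _, hNk z⟩, unitsIncl_mul_smul hδ z⟩
  have hE' : ∀ u : Lˣ, u ∈ (unitsE R ⊓ (unitsIncl k R).range).map (unitsIncl R L) ↔
      u ∈ unitsE L ∧ σ • u = u ∧ τ • u = u := fun u => by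
    constructor
    · rintro ⟨y, ⟨hy, hyk⟩, rfl⟩
      refine ⟨(unitsIncl_mem_unitsE_iff _).mpr hy, smul_unitsIncl_eq hR _, ?_⟩
      rw [← unitsIncl_smul hδ, (mem_range_unitsIncl_k_iff hgenk y).mp hyk]
    · rintro ⟨hu, hσu, hτu⟩
      obtain ⟨y, hy, rfl⟩ := exists_unitsE_R_of_fixed hR hu hσu
      refine ⟨y, ⟨hy, (mem_range_unitsIncl_k_iff hgenk y).mpr (hφ ?_)⟩, rfl⟩
      rw [unitsIncl_smul hδ, hτu]
  have hsup : (unitsE R ⊓ (unitsIncl k R).range).map (unitsIncl R L) ⊔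
      (unitsE L ⊓ (⊤ : Subgroup Lˣ).map (Herbrand.norm (L ≃ₐ[K] L))) =
      unitsE L ⊓ (unitsIncl K L).range := by
    refine le_antisymm (sup_le (fun u hu => ?_) (fun u hu => ?_)) (fun u hu => ?_)
    · obtain ⟨hu, -, hτu⟩ := (hE' u).mp hu
      exact (hE u).mpr ⟨hu, hτu⟩
    · obtain ⟨hu, x, hxu⟩ := (hA u).mp hu
      exact (hE u).mpr ⟨hu, by rw [← hxu, smul_mul', tau_smul_two hτ, mul_comm]⟩
    · obtain ⟨hu, hτu⟩ := (hE u).mp hu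
      obtain ⟨h1, h2, h3⟩ := eq_norm3_mul_norm_of_fixed hσ hτσ hτu
      rw [h1]
      exact Subgroup.mul_mem_sup ((hE' _).mpr ⟨hN3 hu, h2, h3⟩)
        ((hA _).mpr ⟨Subgroup.mul_mem _ (Subgroup.inv_mem _ (smul_mem_unitsE σ hu))
          (smul_mem_unitsE τ (Subgroup.inv_mem _ (smul_mem_unitsE σ hu))), _, rfl⟩)
  have hinf : (unitsE L ⊓ (⊤ : Subgroup Lˣ).map (Herbrand.norm (L ≃ₐ[K] L))) ⊓
      (unitsE R ⊓ (unitsIncl k R).range).map (unitsIncl R L) =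
      (unitsE R ⊓ (⊤ : Subgroup Rˣ).map (Herbrand.norm (R ≃ₐ[k] R))).map (unitsIncl R L) := by
    refine le_antisymm (fun u hu => ?_) (fun u hu => ?_)
    · obtain ⟨huA, huE⟩ := Subgroup.mem_inf.mp hu
      obtain ⟨hu, hσu, hτu⟩ := (hE' u).mp huE
      obtain ⟨-, x, hxu⟩ := (hA u).mp huA
      obtain ⟨e1, e2⟩ := eq_norm_norm3_of_fixed_norm hσ hτσ hσu hτu hxu.symm
      exact (hA' u).mpr ⟨hu, hσu, _, e2, e1.symm⟩
    · obtain ⟨hu, hσu, x, hσx, hxu⟩ := (hA' u).mp hu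
      exact Subgroup.mem_inf.mpr ⟨(hA u).mpr ⟨hu, x, hxu⟩, (hE' u).mpr ⟨hu, hσu, by
        rw [← hxu, smul_mul', tau_smul_two hτ, mul_comm]⟩⟩
  rw [← Subgroup.relIndex_map_map_of_injective
    (unitsE R ⊓ (⊤ : Subgroup Rˣ).map (Herbrand.norm (R ≃ₐ[k] R))) (unitsE R ⊓ (unitsIncl k R).range)
    hφ, ← hinf, Subgroup.inf_relIndex_right, ← hsup, Subgroup.relIndex_sup_right]

end Indices

end Literature.NumberTheory.NumberFields.DihedralUnits
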